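import Summits.ResolutionOfSingularities.ResolutionOfSingularities.Theorems.WildConesClassicalRegimesDefs

/-!
# [OURS · L1 W4.6, rung (i) — STATEMENTS] Surfaces `z^p = a(u₁,u₂)` in 3-space, forced regime of route
# `WildCones`' point-blow-up dynamics: the rung statements as predicates in the characteristic `p`
# (statement-only file; cell res-hironaka, LADDER-RESOLUTION rung L, D-0089; slot W4.6)

HONEST FRAMING. Everything below is OURS: PREDICATES (in the characteristic `p`) over route `WildCones`' own typed
point-blow-up dynamics `Theorems/WildConesClassicalRegimesDefs.lean` (`step`/`run`/`Isol`/`MultP`/`OrdP`/`OrdPSucc`/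
`mu`/`InfRun`), written in the pattern of the rung-(ii) statement file
`Theorems/WildConesCampaignW46ThreefoldsCharTwoStatement.lean` (res-L1-type-o1, p468935) so that (a) the slot planner
res-L1-s46-plan-1 can register the rank-9 item of rung (i) with a signature that is a single constant and close it `--by`
a prover's theorem, and (b) the OURS lanes sign ONE decl per rung statement. NOTHING here is a statement of
H. Hironaka's manuscript [Hironaka2017]; the decls REPLACE THE ROLE of Th. 16.13 p.87 l.26–28 («repeatedly but finitely
many times») and of Th. 16.6 (2) / Eq. (127) p.84 l.10–20 (strict decrease of the résumé's `Inv`-string) in ONE restricted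
regime — (i) SURFACES `z^p = a(u₁,u₂)` embedded in 3-space, in the FORCED regime (isolated point of multiplicity `p`, where
every centre rule, in particular the typed one, must blow up the closed point: `CampaignW46.Run.centre_eq_sing`,
`Theorems/MarkedTransferCampaignW46ForcedRegime.lean`) — with OUR invariant, the Milnor number `μ = dim_κ κ⟦u⟧/(∂a)`.
The statements quantify over EVERY field of characteristic `p` (no `[PerfectField κ]`): the PROOFS for every prime `p`
(seat res-L1-s46-pv-2, `Theorems/WildConesCampaignW46SurfacesProof.lean`) reduce to the perfect-field theorems of
`Theorems/WildConesCampaignW46Surfaces.lean` (p469938) by base change to an algebraic closure (route `JacobianBudget`'s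
kit `stub_baseChange`: `Isol`, `MultP`, `μ` are invariant and `step` commutes with extension of the ground field). The
scheme half of the dictionary to the typed §16 procedure is NOT claimed (formal half:
`Theorems/WildConesCampaignW46FormalDictionary.lean`). AI review is weaker than expert review. No `sorry`, no theorem.

## Decls (namespace `…Theorems`)

* `CampaignW46SurfacesForcedExit p` — THE RUNG STATEMENT (Th. 16.13-role WITH A NUMBER): over every field of
  characteristic `p`, every run of the dynamics of `z^p = a(u₁,u₂)` leaves the forced regime within `μ(c₀) + 1` steps.
* `CampaignW46SurfacesNoInfRun p` — the weak form `¬ WildCones.InfRun p 2 κ c₀ i t` (= the `n = 2` conjunct of the crux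
  `ClassicalRegimes` WITHOUT `[PerfectField κ]`).
* `CampaignW46SurfacesForcedOrder p` — the STRUCTURE of the forced surface regime: a state of multiplicity `p` whose
  successor is forced has cleaned order EXACTLY `p + 1` (`¬ OrdP ∧ OrdPSucc`; hence `< 2p`, inside the Moh window —
  link to rung (iii)).
* `CampaignW46SurfacesMuDropLookahead p` — the Eq. (127)-role WITH ONE STEP OF LOOK-AHEAD: `c`, `c′` forced and `c″` of
  multiplicity `p` ⇒ `μ(c′) < μ(c)`. The look-ahead-free one-step form is the existing predicate
  `CampaignW46HypersurfacesMuDrop p 2` (p468935): PROVED at `p = 2` (res-L1-s46-pv-4, `muDrop_two`), OPEN for odd `p`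
  (the case «`c′` forced of cleaned order exactly `p`» is not covered by the crux's colength engine) — recorded here as
  the open instance it is, not claimed.

VACUITY. Not vacuous for prime `p`: forced surface states with forced successors exist (e.g. `z^p = u₁u₂^p + u₁^p u₂ + …`
families, and for `p = 2` res-L1-s46-pv-4's `z² = u₀u₁ + u₂^{2j+1}` restricted pattern), `μ` is finite exactly under `Isol`;
no notion parameters (no junk-instance reading). For `p` not a prime the predicates are about a degenerate calculus and
are claimed by nobody.

References: res-L1-s46-pv-2 STATUS 2026-08-26 (hand-over, proposed signature for rung (i)); Theorems/WildConesCampaignW46Surfaces.lean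
(p469938); Theorems/WildConesCampaignW46ThreefoldsCharTwoStatement.lean (p468935, the pattern); route file Theses/WildCones.lean
(`ClassicalRegimes`, stmt-16884); plan/SIZED-ASK-L.md v0.2 §S S-s46 (rung (i)). H. Hironaka, ms. 2017, Th. 16.6 p.84, Th. 16.13
p.87 — quoted for the ROLE replaced only, under adjudication, not cited as fact.
-/

noncomputable section

set_option linter.dupNamespace false -- mandated namespace of this single-conjunct summit

namespace Summit.ResolutionOfSingularities.ResolutionOfSingularities.Theorems

/-- [OURS · L1 W4.6 rung (i)] replaces the role of the termination half of Th. 16.13 p.87 l.26–28 for SURFACE `p`-FOLD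
POINTS `z^p = a(u₁,u₂)` in characteristic `p`, in the forced (isolated) regime of route WildCones' point-blow-up dynamics,
WITH AN EFFECTIVE BOUND; NOT a statement of the manuscript. For every field `κ` of characteristic `p`, every start
`c₀ : (Fin 2 → ℕ) → κ` (coefficients of `a`), every chart word `i` and translation word `t`, some stage `m ≤ μ(c₀) + 1` of
the run is NOT a forced state (not both isolated and of multiplicity `p`). A PREDICATE in `p`; for every PRIME `p` it is
res-L1-s46-pv-2's proposed item signature (STATUS 2026-08-26) and is proved in `…CampaignW46SurfacesProof`. [folklore] -/
def CampaignW46SurfacesForcedExit (p : ℕ) : Prop :=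
  ∀ (κ : Type) [Field κ] [CharP κ p] (c₀ : (Fin 2 → ℕ) → κ) (i : ℕ → Fin 2) (t : ℕ → Fin 2 → κ),
    ∃ m ≤ WildCones.mu p 2 κ c₀ + 1,
      ¬ (WildCones.Isol p 2 κ (WildCones.run p 2 κ c₀ i t m) ∧ WildCones.MultP p 2 κ (WildCones.run p 2 κ c₀ i t m))

/-- [OURS · L1 W4.6 rung (i), weak form] «no infinite forced run» for surface `p`-fold points `z^p = a(u₁,u₂)` in
characteristic `p`: `¬ WildCones.InfRun p 2 κ c₀ i t` for EVERY field `κ` of characteristic `p` and all `c₀, i, t` (the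
`n = 2` conjunct of the crux `ClassicalRegimes`, stated without `[PerfectField κ]`). Predicate in `p`; proved for every
prime `p` in `…CampaignW46SurfacesProof`. NOT a statement of the manuscript. [folklore] -/
def CampaignW46SurfacesNoInfRun (p : ℕ) : Prop :=
  ∀ (κ : Type) [Field κ] [CharP κ p] (c₀ : (Fin 2 → ℕ) → κ) (i : ℕ → Fin 2) (t : ℕ → Fin 2 → κ),
    ¬ WildCones.InfRun p 2 κ c₀ i t

/-- [OURS · L1 W4.6 rung (i), the REGIME STRUCTURE; NOT a statement of the manuscript] **The forced surface regime lives
in cleaned order exactly `p + 1`**: over every field of characteristic `p`, a state of `z^p = a(u₁,u₂)` of multiplicity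
`p` whose point-blow-up successor is forced (isolated of multiplicity `p`) has NO cleaned monomial of degree `p` and SOME
cleaned monomial of degree `p + 1` — cleaned order `p` exits multiplicity `p` in one blow-up, cleaned order `≥ p + 2`
has no isolated successor. Consequence: such states satisfy `ord a = p + 1 < 2p`, the Moh window of rung (iii).
Predicate in `p`; proved for every prime `p` in `…CampaignW46SurfacesProof`. [folklore] -/
def CampaignW46SurfacesForcedOrder (p : ℕ) : Prop :=
  ∀ (κ : Type) [Field κ] [CharP κ p] (c : (Fin 2 → ℕ) → κ) (i : Fin 2) (τ : Fin 2 → κ),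
    WildCones.MultP p 2 κ c → WildCones.Isol p 2 κ (WildCones.step p 2 κ i τ c) →
      WildCones.MultP p 2 κ (WildCones.step p 2 κ i τ c) →
        ¬ WildCones.OrdP p 2 κ c ∧ WildCones.OrdPSucc p 2 κ c

/-- [OURS · L1 W4.6 rung (i), one-step form WITH LOOK-AHEAD] replaces the role of Th. 16.6 (2) / Eq. (127) p.84 l.10–20
for surface `p`-fold points `z^p = a(u₁,u₂)` with OUR invariant the Milnor number: over every field of characteristic
`p`, if `c` and `c′ = step i τ c` are forced and the next state `c″ = step i′ τ′ c′` still has multiplicity `p`, then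
`μ(c′) < μ(c)`. The look-ahead-free form is `CampaignW46HypersurfacesMuDrop p 2`
(`Theorems/WildConesCampaignW46ThreefoldsCharTwoStatement.lean`), proved at `p = 2` and OPEN for odd `p` (case «`c′`
forced of cleaned order exactly `p`»); this predicate is what the tree's colength engine yields for every `p`. Proved for
every prime `p` in `…CampaignW46SurfacesProof`. NOT a statement of the manuscript. [folklore] -/
def CampaignW46SurfacesMuDropLookahead (p : ℕ) : Prop :=
  ∀ (κ : Type) [Field κ] [CharP κ p] (c : (Fin 2 → ℕ) → κ) (i : Fin 2) (τ : Fin 2 → κ) (i' : Fin 2)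
    (τ' : Fin 2 → κ),
    WildCones.Isol p 2 κ c → WildCones.MultP p 2 κ c →
      WildCones.Isol p 2 κ (WildCones.step p 2 κ i τ c) → WildCones.MultP p 2 κ (WildCones.step p 2 κ i τ c) →
        WildCones.MultP p 2 κ (WildCones.step p 2 κ i' τ' (WildCones.step p 2 κ i τ c)) →
          WildCones.mu p 2 κ (WildCones.step p 2 κ i τ c) < WildCones.mu p 2 κ c

end Summit.ResolutionOfSingularities.ResolutionOfSingularities.Theorems

end
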